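import Literature.Analysis.FunctionSpaces.TorusFourierSeries

/-!
# Smooth Fourier tails on `T³` (stub TAIL of line `Sketch`, crux stmt-AnomalousDissipation-15122)

For a smooth real vector field `f` on `T³` and any `q : ℕ` there is a constant `C ≥ 0` with
`∑ₖ ‖f̂ k‖ ≤ C` and, for every radius `L ≥ 1`, `∑_{k ∉ ball L} ‖f̂ k‖ ≤ C / L^q` (the tail is
written as the indicator-masked family over all of `ℤ³`, which is how the far-field bookkeeping
of the line consumes it).

Proof: polynomial decay of the coefficients of a smooth field,
`‖f̂ k‖ ≤ K ((1 + |k|²)^{3+q})⁻¹` (`Torus.norm_mFourierCoeff_le_of_iterate_bound` with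
`Torus.exists_iterate_bound`), the elementary inequality `(1 + |k|²)^{3+q} ≥ (1 + |k|²)³ · L^q`
off the ball (`Torus.not_mem_freqBall`: `L² < |k|²`), and the lattice sum
`∑ₖ ((1 + |k|²)³)⁻¹ < ∞` (`Torus.summable_inv_one_add_freqNormSq_pow_card`).
-/

noncomputable section

set_option linter.dupNamespace false

open MeasureTheory UnitAddTorus
open scoped BigOperators

namespace Summit.AnomalousDissipation.AnomalousDissipation.Theorems.KolmogorovFloor.Response

open Literature.Analysis.FunctionSpaces

/-- **TAIL.** The Fourier coefficients of a smooth field on `T³` are summable in norm, and their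
mass outside the frequency ball of radius `L ≥ 1` is at most `C / L^q`, for every `q : ℕ`, with a
constant `C = C(f, q) ≥ 0` that also bounds the full sum `∑ₖ ‖f̂ k‖`. -/
theorem fourierTail : ∀ f : UnitAddTorus (Fin 3) → EuclideanSpace ℝ (Fin 3), Torus.IsSmooth f → ∀ q : ℕ,
    ∃ C : ℝ, 0 ≤ C ∧
      Summable (fun κ : Fin 3 → ℤ => ‖mFourierCoeff (EuclideanSpace.complexify ∘ f) κ‖) ∧
      (∑' κ : Fin 3 → ℤ, ‖mFourierCoeff (EuclideanSpace.complexify ∘ f) κ‖) ≤ C ∧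
      ∀ L : ℕ, 1 ≤ L →
        Summable (fun κ : Fin 3 → ℤ =>
          if κ ∈ Torus.freqBall L then (0 : ℝ) else ‖mFourierCoeff (EuclideanSpace.complexify ∘ f) κ‖) ∧
        (∑' κ : Fin 3 → ℤ,
          (if κ ∈ Torus.freqBall L then (0 : ℝ) else ‖mFourierCoeff (EuclideanSpace.complexify ∘ f) κ‖)) ≤
            C / (L : ℝ) ^ q := by
  intro f hf q
  -- polynomial decay of order `3 + q`
  obtain ⟨K, hK0, hK⟩ := Torus.exists_iterate_bound hf (Fintype.card (Fin 3) + q)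
  have hdec : ∀ κ : Fin 3 → ℤ, ‖mFourierCoeff (EuclideanSpace.complexify ∘ f) κ‖ ≤
      K * ((1 + Torus.freqNormSq κ) ^ (Fintype.card (Fin 3) + q))⁻¹ :=
    fun κ => Torus.norm_mFourierCoeff_le_of_iterate_bound hf hK κ
  have hsum : Summable (fun κ : Fin 3 → ℤ => ‖mFourierCoeff (EuclideanSpace.complexify ∘ f) κ‖) :=
    Torus.summable_norm_mFourierCoeff_of_isSmooth hf
  have hlat : Summable (fun κ : Fin 3 → ℤ =>
      ((1 + Torus.freqNormSq κ) ^ Fintype.card (Fin 3))⁻¹) :=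
    Torus.summable_inv_one_add_freqNormSq_pow_card
  -- the two constants: the full coefficient sum `A` and the lattice sum `S`
  set S : ℝ := ∑' κ : Fin 3 → ℤ, ((1 + Torus.freqNormSq κ) ^ Fintype.card (Fin 3))⁻¹ with hS
  set A : ℝ := ∑' κ : Fin 3 → ℤ, ‖mFourierCoeff (EuclideanSpace.complexify ∘ f) κ‖ with hA
  have hA0 : 0 ≤ A := tsum_nonneg fun κ => norm_nonneg _
  refine ⟨max A (K * S), le_max_of_le_left hA0, hsum, le_max_left _ _, fun L hL => ?_⟩
  -- the masked family and its majorant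
  set g : (Fin 3 → ℤ) → ℝ := fun κ =>
    if κ ∈ Torus.freqBall L then (0 : ℝ) else ‖mFourierCoeff (EuclideanSpace.complexify ∘ f) κ‖
    with hg
  have hg0 : ∀ κ, 0 ≤ g κ := fun κ => by
    simp only [hg]
    split_ifs
    · exact le_rfl
    · exact norm_nonneg _
  have hgle : ∀ κ, g κ ≤ ‖mFourierCoeff (EuclideanSpace.complexify ∘ f) κ‖ := fun κ => by
    simp only [hg]
    split_ifs
    · exact norm_nonneg _
    · exact le_rfl
  have hgs : Summable g := Summable.of_nonneg_of_le hg0 hgle hsum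
  refine ⟨hgs, ?_⟩
  have hL1 : (1 : ℝ) ≤ (L : ℝ) := by exact_mod_cast hL
  have hLq : 0 < (L : ℝ) ^ q := pow_pos (by linarith) q
  have hmaj : ∀ κ, g κ ≤
      K * ((L : ℝ) ^ q)⁻¹ * ((1 + Torus.freqNormSq κ) ^ Fintype.card (Fin 3))⁻¹ := by
    intro κ
    have hb : 0 < 1 + Torus.freqNormSq κ := by linarith [Torus.freqNormSq_nonneg κ]
    simp only [hg]
    split_ifs with hκ
    · exact mul_nonneg (mul_nonneg hK0 (inv_nonneg.2 hLq.le)) (inv_nonneg.2 (pow_nonneg hb.le _))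
    · rw [Torus.not_mem_freqBall] at hκ
      have hLL : (L : ℝ) ≤ (L : ℝ) ^ 2 := by nlinarith
      have hLle : (L : ℝ) ≤ 1 + Torus.freqNormSq κ := by linarith
      calc ‖mFourierCoeff (EuclideanSpace.complexify ∘ f) κ‖
          ≤ K * ((1 + Torus.freqNormSq κ) ^ (Fintype.card (Fin 3) + q))⁻¹ := hdec κ
        _ ≤ K * (((1 + Torus.freqNormSq κ) ^ Fintype.card (Fin 3)) * (L : ℝ) ^ q)⁻¹ := by
            refine mul_le_mul_of_nonneg_left (inv_anti₀ (mul_pos (pow_pos hb _) hLq) ?_) hK0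
            rw [pow_add]
            exact mul_le_mul_of_nonneg_left (pow_le_pow_left₀ (by linarith) hLle q)
              (pow_nonneg hb.le _)
        _ = K * ((L : ℝ) ^ q)⁻¹ * ((1 + Torus.freqNormSq κ) ^ Fintype.card (Fin 3))⁻¹ := by
            rw [mul_inv]
            ring
  have hms : Summable (fun κ : Fin 3 → ℤ =>
      K * ((L : ℝ) ^ q)⁻¹ * ((1 + Torus.freqNormSq κ) ^ Fintype.card (Fin 3))⁻¹) :=
    hlat.mul_left _
  calc ∑' κ, g κ
      ≤ ∑' κ : Fin 3 → ℤ, K * ((L : ℝ) ^ q)⁻¹ * ((1 + Torus.freqNormSq κ) ^ Fintype.card (Fin 3))⁻¹ :=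
        Summable.tsum_le_tsum hmaj hgs hms
    _ = K * S / (L : ℝ) ^ q := by
        rw [tsum_mul_left, hS]
        ring
    _ ≤ max A (K * S) / (L : ℝ) ^ q := by
        gcongr
        exact le_max_right _ _

end Summit.AnomalousDissipation.AnomalousDissipation.Theorems.KolmogorovFloor.Response
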